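import Summits.CriticalPhenomena.PercolationContinuityZ3.Theorems.Transplant.FKDoubleFanOneSidedConeS
import HarnessLib

/-!
# Double fans `K₂ ∨ P_{m+1}`: the `B`-DRESSED `a`-sided cone over the relaxation `InS` — one all-affine closure statement whose cells decompose
# into structured atoms

Helper file (`--supports stmt-CriticalPhenomena-4575`), FK sub-lane `prim-bschramm-fk-3` (gen 37); builds on p205010 (kernel theorem, internal audit
signed; external expert review pending).  No named facts, no sorries; standard axioms.  Memo `bschramm/prim-bschramm-fk-3/FAR-CROSS-XII.md` §8.

Variant of `…OneSidedConeS` with a larger generating family: the bi-dual **`osConeABS q`** of the `a`-images `imgA q F w` TOGETHER WITH their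
`b`-spoke dressings `opBC y (imgA q F w)` (`F, w ∈ InS q`, `y ∈ [0,1]`; dual **`OSDualABS`**).  Inputs lie in it; targets pair `≥ 0` with it by
LEMMA′ on the relaxation and `∧²BC_y (target) = (1−y)·target` (**`opBC_target`**); `a`-spokes and repeated `b`-spokes act on the generators by the
identities `∧²AC_x ∧²BC_y = ∧²BC_y ∧²AC_x` (**`opAC_opBC`**) and `∧²BC_y ∧²BC_{y'} = ∧²BC_{y+y'−yy'}` (**`opBC_opBC`**).  The ONLY closure condition
left is the rim step after a `b`-spoke:
  **(CL⁺_S)** `HypEBaS q`: `opE q r (opBC y (imgA q F w)) ∈ osConeABS q` for all `F, w ∈ InS q`, `y, r ∈ [0,1]`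
(**`isLetterCone_osConeABS`**), whence **`negCorr_spokes_cross_far_of_hypEBaS`** (all middles, `0 < q ≤ 1`).  `HypBaS ⟹ HypEBaS`
(**`hypEBaS_of_hypBaS`**), so (CL⁺_S) is the weaker requirement; numerically its cells — unlike those of `HypBaS` — have EXACT decompositions into
STRUCTURED dressed atoms `∧²BC_s · imgA (fan word) (letter · rest)` (memo §8), which is why this variant is recorded.
[folklore]
-/

noncomputable section

namespace Summit.CriticalPhenomena.PercolationContinuityZ3.Theorems

namespace FK

namespace ThreeApex

/-! ### Letter identities on bivectors -/

/-- `a`- and `b`-spokes commute on bivectors: `∧²AC_x ∧²BC_y = ∧²BC_y ∧²AC_x`. [folklore] -/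
theorem opAC_opBC (x y : ℝ) (β : Biv) : opAC x (opBC y β) = opBC y (opAC x β) := by
  ext <;> simp only [opAC, opBC, opTa, opWa, opTb, opWb, Biv.lin3, Biv.add, Biv.smul] <;> ring

/-- Two `b`-spokes at one vertex are one `b`-spoke: `∧²BC_y ∧²BC_{y'} = ∧²BC_{y + y' − yy'}`. [folklore] -/
theorem opBC_opBC (y y' : ℝ) (β : Biv) : opBC y (opBC y' β) = opBC (y + y' - y * y') β := by
  ext <;> simp only [opBC, opTb, opWb, Biv.lin3, Biv.add, Biv.smul] <;> ring

/-- **A `b`-spoke on a target rescales it**: `∧²BC_y ((s∗BC_0) ∧ (s∗BC_1)) = (1−y)·((s∗BC_0) ∧ (s∗BC_1))`. [folklore] -/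
theorem opBC_target (y : ℝ) (s : V5) :
    opBC y (wedgeH (conv s (edgeBC 0)) (conv s (edgeBC 1))) = Biv.smul (1 - y) (wedgeH (conv s (edgeBC 0)) (conv s (edgeBC 1))) := by
  ext <;> simp only [opBC, opTb, opWb, wedgeH, conv, edgeBC, hx, hy, hz, V5.total, Biv.lin3, Biv.add, Biv.smul] <;> ring

/-! ### The dressed dual and bi-dual over `InS` -/

/-- The dual of the `a`-images over `InS` and of their `b`-spoke dressings. [folklore] -/
def OSDualABS (q : ℝ) (γ : Biv) : Prop :=
  (∀ F w : V5, InS q F → InS q w → 0 ≤ pairH q (imgA q F w) γ) ∧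
    (∀ (F w : V5) (y : ℝ), InS q F → InS q w → 0 ≤ y → y ≤ 1 → 0 ≤ pairH q (opBC y (imgA q F w)) γ)

/-- **The dressed `a`-sided cone over the relaxation**: the bi-dual of `{imgA F w} ∪ {∧²BC_y (imgA F w)}`, `F, w ∈ InS q`. [folklore] -/
def osConeABS (q : ℝ) : Set Biv := {β | ∀ γ : Biv, OSDualABS q γ → 0 ≤ pairH q β γ}

/-- `a`-images lie in the dressed cone. [folklore] -/
theorem imgA_mem_osConeABS {q : ℝ} {F w : V5} (hF : InS q F) (hw : InS q w) : imgA q F w ∈ osConeABS q :=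
  fun _ hγ => hγ.1 F w hF hw

/-- Dressed `a`-images lie in the dressed cone. [folklore] -/
theorem opBC_imgA_mem_osConeABS {q : ℝ} {F w : V5} {y : ℝ} (hF : InS q F) (hw : InS q w) (hy0 : 0 ≤ y) (hy1 : y ≤ 1) :
    opBC y (imgA q F w) ∈ osConeABS q :=
  fun _ hγ => hγ.2 F w y hF hw hy0 hy1

/-- **Inputs lie in the dressed cone** (`u ∈ InKE q`, `0 < q ≤ 1`). [folklore] -/
theorem input_mem_osConeABS {q : ℝ} (hq0 : 0 < q) (hq1 : q ≤ 1) {u : V5} (hu : InKE q u) :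
    wedgeH (conv (edgeAC 0) u) (conv (edgeAC 1) u) ∈ osConeABS q := by
  rw [← imgA_fanInit]; exact imgA_mem_osConeABS ((fanInit_inKE q).inS hq0 hq1) (hu.inS hq0 hq1)

/-- The dressed dual is contained in the undressed one. [folklore] -/
theorem OSDualABS.osDualS {q : ℝ} {γ : Biv} (h : OSDualABS q γ) : OSDualS q γ := h.1

/-- **The undressed cone is the smaller bi-dual**: `osConeS q ⊆ osConeABS q`. [folklore] -/
theorem osConeS_subset_osConeABS (q : ℝ) : osConeS q ⊆ osConeABS q :=
  fun _ hβ γ hγ => hβ γ hγ.osDualS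

/-- **(CL⁺_S)**: a rim step applied to a `b`-spoke-dressed `a`-image stays in the dressed cone. [folklore] -/
def HypEBaS (q : ℝ) : Prop :=
  ∀ (F w : V5) (y r : ℝ), InS q F → InS q w → 0 ≤ y → y ≤ 1 → 0 ≤ r → r ≤ 1 → opE q r (opBC y (imgA q F w)) ∈ osConeABS q

/-- `HypBaS` (the undressed closure statement) implies `HypEBaS` (`0 < q ≤ 1`). [folklore] -/
theorem hypEBaS_of_hypBaS {q : ℝ} (hq0 : 0 < q) (hq1 : q ≤ 1) (h : HypBaS q) : HypEBaS q := by
  intro F w y r hF hw hy0 hy1 hr0 hr1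
  exact osConeS_subset_osConeABS q ((isLetterCone_osConeS hq0 hq1 h).rim r _ hr0 hr1 (h F w y hF hw hy0 hy1))

namespace OSDualABS

variable {q : ℝ} {γ : Biv}

/-- The dressed dual is stable under rim steps, given (CL⁺_S) (`0 < q ≤ 1`). [folklore] -/
theorem rim (hq0 : 0 < q) (hq1 : q ≤ 1) (hγ : OSDualABS q γ) (hEB : HypEBaS q) {r : ℝ} (hr0 : 0 ≤ r) (hr1 : r ≤ 1) :
    OSDualABS q (opE q r γ) := by
  refine ⟨fun F w hF hw => ?_, fun F w y hF hw hy0 hy1 => ?_⟩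
  · rw [← pairH_opE, opE_imgA]; exact hγ.1 _ _ (hF.rimStep hq0 hq1 hr0 hr1) hw
  · rw [← pairH_opE]; exact hEB F w y r hF hw hy0 hy1 hr0 hr1 γ hγ

/-- The dressed dual is stable under `a`-spokes (`0 < q ≤ 1`). [folklore] -/
theorem ac (hq0 : 0 < q) (hq1 : q ≤ 1) (hγ : OSDualABS q γ) {x : ℝ} (hx0 : 0 ≤ x) (hx1 : x ≤ 1) : OSDualABS q (opAC x γ) := by
  refine ⟨fun F w hF hw => ?_, fun F w y hF hw hy0 hy1 => ?_⟩
  · rw [← pairH_opAC, opAC_imgA]; exact hγ.1 _ _ (hF.step hq0 hq1 (IsLetter.bc hx0 hx1)) hw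
  · rw [← pairH_opAC, opAC_opBC, opAC_imgA]; exact hγ.2 _ _ y (hF.step hq0 hq1 (IsLetter.bc hx0 hx1)) hw hy0 hy1

/-- The dressed dual is stable under `b`-spokes. [folklore] -/
theorem bc (hγ : OSDualABS q γ) {y : ℝ} (hy0 : 0 ≤ y) (hy1 : y ≤ 1) : OSDualABS q (opBC y γ) := by
  refine ⟨fun F w hF hw => ?_, fun F w y' hF hw hy0' hy1' => ?_⟩
  · rw [← pairH_opBC]; exact hγ.2 F w y hF hw hy0 hy1
  · rw [← pairH_opBC, opBC_opBC]
    exact hγ.2 F w _ hF hw (by nlinarith) (by nlinarith)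

end OSDualABS

/-- **Under (CL⁺_S) the dressed cone is a letter cone** (`0 < q ≤ 1`). [folklore] -/
theorem isLetterCone_osConeABS {q : ℝ} (hq0 : 0 < q) (hq1 : q ≤ 1) (hEB : HypEBaS q) : IsLetterCone q (osConeABS q) where
  zero_mem := fun γ _ => le_of_eq (pairH_zero_left q γ).symm
  add_mem := fun β γ hβ hγ δ hδ => by rw [pairH_add_left]; exact add_nonneg (hβ δ hδ) (hγ δ hδ)
  smul_mem := fun a β ha hβ δ hδ => by rw [pairH_smul_left]; exact mul_nonneg ha (hβ δ hδ)
  rim := fun r β hr0 hr1 hβ γ hγ => by rw [pairH_opE]; exact hβ _ (hγ.rim hq0 hq1 hEB hr0 hr1)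
  ac := fun x β hx0 hx1 hβ γ hγ => by rw [pairH_opAC]; exact hβ _ (hγ.ac hq0 hq1 hx0 hx1)
  bc := fun y β hy0 hy1 hβ γ hγ => by rw [pairH_opBC]; exact hβ _ (hγ.bc hy0 hy1)

/-- **Every target lies in the dressed dual** (`0 < q < 1`, `s ∈ InKE q`). [folklore] -/
theorem target_osDualABS {q : ℝ} (hq0 : 0 < q) (hq1 : q < 1) {s : V5} (hs : InKE q s) :
    OSDualABS q (wedgeH (conv s (edgeBC 0)) (conv s (edgeBC 1))) := by
  refine ⟨fun F w hF hw => target_osDualS hq0 hq1 hs F w hF hw, fun F w y hF hw hy0 hy1 => ?_⟩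
  rw [pairH_opBC, opBC_target, pairH_comm, pairH_smul_left, pairH_comm]
  exact mul_nonneg (sub_nonneg.2 hy1) (target_osDualS hq0 hq1 hs F w hF hw)

/-- The dressed cone pairs non-negatively with every target (`0 < q < 1`). [folklore] -/
theorem pairH_osConeABS_target {q : ℝ} (hq0 : 0 < q) (hq1 : q < 1) {s : V5} (hs : InKE q s) :
    ∀ β, β ∈ osConeABS q → 0 ≤ pairH q β (wedgeH (conv s (edgeBC 0)) (conv s (edgeBC 1))) :=
  fun _ hβ => hβ _ (target_osDualABS hq0 hq1 hs)

/-! ### The reduction -/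

/-- **(CL⁺_S) ⟹ THE ALGEBRA-LEVEL FAR THEOREM** (`0 < q ≤ 1`). [folklore] -/
theorem rayleigh_crossFar_of_hypEBaS {q : ℝ} (hq0 : 0 < q) (hq1 : q ≤ 1) (hEB : HypEBaS q) :
    ∀ (mids : List (ℝ × ℝ × ℝ)), UnitBlocks mids → ∀ rd : ℝ, 0 ≤ rd → rd ≤ 1 → ∀ u s : V5, InKE q u → InKE q s →
      0 ≤ crossFarZ q mids rd u s 1 0 * crossFarZ q mids rd u s 0 1 - crossFarZ q mids rd u s 1 1 * crossFarZ q mids rd u s 0 0 := by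
  intro mids hm rd hrd0 hrd1 u s hu hs
  rcases eq_or_lt_of_le hq1 with h1 | h1
  · subst h1
    exact rayleigh_crossFar_of_hypBa one_pos le_rfl hypBa_one mids hm rd hrd0 hrd1 u s hu hs
  · have key := rayleigh_crossFar_of_isLetterCone (isLetterCone_osConeABS hq0 hq1 hEB) hm hrd0 hrd1 (input_mem_osConeABS hq0 hq1 hu)
      (pairH_osConeABS_target hq0 h1 hs)
    simp only [crossFarZ]
    linarith [key]

open MeasureTheory Literature.Probability.LatticeModels Literature.Probability.Percolation
open scoped Classical

variable {V : Type*} [Fintype V]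

section Setting

variable {a b : V} {c : ℕ → V} {m : ℕ}
variable (hab : a ≠ b) (hinj : ∀ j k, j ≤ m → k ≤ m → c j = c k → j = k) (hca : ∀ j, j ≤ m → c j ≠ a) (hcb : ∀ j, j ≤ m → c j ≠ b)
include hab hinj hca hcb

/-- **(CL⁺_S) ⟹ NEGATIVE CORRELATION OF EVERY CROSS-APEX PAIR AT EVERY DISTANCE** (`0 < q ≤ 1`; every weighted double fan, every middle).
[folklore] -/
theorem negCorr_spokes_cross_far_of_hypEBaS (hcard : Fintype.card V = m + 3) {q : ℝ} (hq0 : 0 < q) (hq1 : q ≤ 1)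
    (w : Sym2 V → unitInterval) (hsupp : ∀ e, e ∉ dfPairs a b c m → w e = 0) (hEB : HypEBaS q) {j k : ℕ} (hjk : j < k) (hk : k ≤ m) :
    (rcMeasureW w q ∅).real ({ω : BondConfig V | s(a, c j) ∈ ω} ∩ {ω | s(b, c k) ∈ ω}) ≤
      (rcMeasureW w q ∅).real {ω : BondConfig V | s(a, c j) ∈ ω} * (rcMeasureW w q ∅).real {ω : BondConfig V | s(b, c k) ∈ ω} :=
  negCorr_spokes_cross_far_of_inKE hab hinj hca hcb hcard hq0 w hsupp (rayleigh_crossFar_of_hypEBaS hq0 hq1 hEB) hjk hk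

end Setting

end ThreeApex

end FK

end Summit.CriticalPhenomena.PercolationContinuityZ3.Theorems
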